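import Summits.QuantumFields.BalabanUV.T4Continuum.Support.NE7HintOfLandauELChartGeneric
import Summits.QuantumFields.BalabanUV.T4Continuum.Support.NE7CubeLandauChart
import HarnessLib

/-!
# NE7HintOfUhlenbeckChartGeneric — PORT MAP P2, FILE 4: (8)∃ WITH THE LANDAU-CHART INPUT DISCHARGED BY THE ONE-SCALE LATTICE UHLENBECK LEMMA, FOR EVERY UNITARY GAUGE GROUP `U(n)`
# AND EVERY BLOCK SIZE `L ≥ 2` ON T⁴ — `NE7HintOfUhlenbeckChartSU2DecSlice.hint_SU2` (F314b, `card n = 2`, `L = 2`) RE-ISSUED GENERICALLY over P2.3 `hint_of_landauELChart_generic`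
# and the generic cube Landau chart `NE7CubeLandauChart.cube_landau_chart`; the regime arithmetic `regime_arith` (which closed its `card n`-line by `norm_num` at `card n = 2`) becomes
# **`regime_arith_card`** with the radius cap `ε ≤ 1∕(2.5·10¹⁰·c²·card n)`, `c = 2·nbRad 4 L + 4ℓ + 28`

Cell `pub-balaban`, rung (B)+1 sub-cell t4, lineage `b2b-balaban-t4-ne7-p1`, generation 109 (CRUX PROVER NE7 #1 = OWNER of BINDER row NE7).  Memo
`t4/b2b-balaban-t4-ne7-p1-g109/ROAD-G109.md` §3 (PORT MAP item P2.4).  NON-VERBATIM POINTS: `nbRad 4 L` for `20`; `M = L^{k+1}`; `r ≤ ε∕L² ≤ ε∕4`; the `card n`-dependent radius cap.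
WHAT ([folklore]; 0 def, 0 sorry).  `regime_arith_card` (pure real); **`hint_generic`**: for every `L ≥ 2`: `∃ C_E > 0, ∃ ℓ ≥ 1, ∃ ε₀ > 0, ∀ 0 < ε ≤ ε₀, ∃ β₀ > 0, ∀ 0 < β ≤ β₀, ∀ N ≥ 1, ∀ αh νh κh`:
the strict line (with `C_E`) and `hdecomp` over `𝒯_E` ⟹ `∃ δ_V > 0`, over the small data every level has a constrained minimiser over `sfClass 4 L N ε` with `SmallField U a`,
`0 ≤ a < ε∕(L^k)²` — F314b TOKEN FOR TOKEN under the recipe; THE CHART is now a theorem for every `(L, n)`.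
HONEST FRAMING (page 1): composition of landed kernel theorems (the cube Landau chart = comb gauge + principal logarithms + the one-scale lattice Uhlenbeck lemma by incremental minimisation,
all [folklore] and generic); constants existential; nothing of Bałaban's asserted; `hdecomp` and the strict line REMAIN HYPOTHESES (generic discharge = PORT MAP P2.5–P2.6); NE7 NOT proved;
spine 0∕9; finite T⁴ rung (B)+1 — NOT infinite volume, NOT mass gap, NOT BetaPertH, NOT Clay (continuum YM on T⁴ ⇐ BetaPertH ∧ nine spine estimates).
-/

set_option autoImplicit false

open scoped BigOperators Matrix Matrix.Norms.L2Operator Topology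
open NormedSpace Finset Set Filter

namespace Summit.QuantumFields.BalabanUV.T4Continuum.NE7HintOfUhlenbeckChartGeneric

open Literature.MathematicalPhysics.QuantumFieldTheory.Balaban1983to89
open B7Prop1Explicit B7Prop2Explicit MatrixLog UnitaryModel MatrixNorms
open B4TorusKernel.MultiPeriod (torusSupNorm)
open B8Ineq132 (covDiv)
open T4AveragingDeficitWall (Ad IsUnitaryCfg IsSkewDir SmallField vary curl curlSq dirSq dirL1)
open T4AveragingDeficitWallBoundary (IsPeriodicCfg periodBox)
open AveragingDeficitPeriodicCounting (IsPeriodicDir)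
open AveragingDeficitMultiLevelPrep (LevelSmall tower TangentIter)
open BlockAverageVaryHolo (nbRad)
open MinimalActionLevels (perWin)
open MinimalActionSandwich (IsMinimiser admissible)
open MinimalActionRate (sfClass)
open NE3HessForm (dAction)
open NE3EnergyShapes (IsUnitarySite)
open NE7HintOfLandauELChartGeneric (hint_of_landauELChart_generic)
open NE3EnergyWeightedShapes (energyNormW)
open NE7MeanZeroGaugeSliceW (energyBlockLandauW)
open NE7CubeLandauChart (cube_landau_chart)

noncomputable section

variable {n : Type*} [Fintype n] [DecidableEq n]

/-! ## §1 The regime arithmetic with the `card n`-dependent radius cap -/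

omit [Fintype n] [DecidableEq n] in
/-- **THE REGIME ARITHMETIC OF THE CUBE LANDAU CHART, ANY `card n = Nn ≥ 1`** (`NE7HintOfUhlenbeckChartSU2.regime_arith` with `Nn = 2 ↦ 1 ≤ Nn` and the cap
`ε ≤ 1∕(2.5·10¹⁰·c²·Nn)`). [folklore] -/
theorem regime_arith_card {M X X₂ c η t₀ ε Nn : ℝ} (hM : 2 ≤ M) (hX : X ≤ c * M) (hX1 : 1 ≤ X) (hX₂ : X₂ ≤ c * M) (hX₂0 : 0 ≤ X₂)
    (hc : 1 ≤ c) (hη : 0 < η) (ht₀ : M ^ 2 * η = t₀) (ht₀ε : t₀ ≤ 5 / 4 * ε) (hNn : 1 ≤ Nn) (hε : ε ≤ 1 / (25000000000 * c ^ 2 * Nn)) :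
    η + 8 * (Real.pi / 2 * (3 * X₂ * η)) * (Real.exp (4 * (Real.pi / 2 * (3 * X₂ * η))) - 1) ≤ 2 * η ∧
    576 * (64 * ((4 : ℕ) : ℝ) ^ 3 * X) ^ 2 * (2 * η) ≤ 1 ∧
    Nn * (1 + 2 * ((4 : ℕ) : ℝ) * X) * (256 * ((4 : ℕ) : ℝ) ^ 3 * X * (2 * η)) ≤ 1 / 2 ∧
    128 * ((4 : ℕ) : ℝ) ^ 3 * X * (2 * η) ≤ 16384 * c * t₀ / M := by
  have hM0 : 0 < M := by linarith
  have hc0 : 0 < c := by linarith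
  have ht₀0 : 0 < t₀ := by rw [← ht₀]; positivity
  have hε0 : 0 < ε := by linarith
  -- `c² t₀ ≤ 5·10⁻¹¹`
  have hNn0 : 0 < Nn := by linarith
  have hctN : Nn * (c ^ 2 * t₀) ≤ 1 / 20000000000 := by
    have h1 : c ^ 2 * t₀ ≤ c ^ 2 * (5 / 4 * ε) := mul_le_mul_of_nonneg_left ht₀ε (by positivity)
    have h2 : c ^ 2 * ε ≤ c ^ 2 * (1 / (25000000000 * c ^ 2 * Nn)) := mul_le_mul_of_nonneg_left hε (by positivity)
    have h3 : Nn * (c ^ 2 * (1 / (25000000000 * c ^ 2 * Nn))) = 1 / 25000000000 := by field_simp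
    have h4 : Nn * (c ^ 2 * t₀) ≤ Nn * (c ^ 2 * (5 / 4 * ε)) := mul_le_mul_of_nonneg_left h1 hNn0.le
    have h5 : Nn * (c ^ 2 * ε) ≤ Nn * (c ^ 2 * (1 / (25000000000 * c ^ 2 * Nn))) := mul_le_mul_of_nonneg_left h2 hNn0.le
    nlinarith
  have hct : c ^ 2 * t₀ ≤ 1 / 20000000000 := by
    have h1 : c ^ 2 * t₀ ≤ Nn * (c ^ 2 * t₀) := le_mul_of_one_le_left (by positivity) hNn
    linarith
  have hct' : c * t₀ ≤ 1 / 20000000000 := by nlinarith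
  -- `Mη = t₀/M ≤ t₀/2`, `X η ≤ c t₀ / M`, `X² η ≤ c² t₀`
  have hMη : M * η = t₀ / M := by rw [← ht₀]; field_simp
  have hMη' : M * η ≤ t₀ / 2 := by rw [hMη]; exact div_le_div_of_nonneg_left ht₀0.le (by norm_num) hM
  have hXη : X * η ≤ c * (t₀ / M) := by
    calc X * η ≤ c * M * η := mul_le_mul_of_nonneg_right hX hη.le
      _ = c * (t₀ / M) := by rw [mul_assoc, hMη]
  have hX₂η : X₂ * η ≤ c * (t₀ / M) := by
    calc X₂ * η ≤ c * M * η := mul_le_mul_of_nonneg_right hX₂ hη.le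
      _ = c * (t₀ / M) := by rw [mul_assoc, hMη]
  have htM : t₀ / M ≤ t₀ / 2 := div_le_div_of_nonneg_left ht₀0.le (by norm_num) hM
  have hX2η : X ^ 2 * η ≤ c ^ 2 * t₀ := by
    have hX0 : 0 ≤ X := by linarith
    calc X ^ 2 * η = X * (X * η) := by ring
      _ ≤ (c * M) * (c * (t₀ / M)) := mul_le_mul hX hXη (by positivity) (by positivity)
      _ = c ^ 2 * t₀ := by field_simp
  -- the logarithm letter `b₀ = (π/2)·3X₂η ≤ 6 c t₀/M ≤ 3 c t₀`
  set b₀ : ℝ := Real.pi / 2 * (3 * X₂ * η) with hb₀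
  have hb₀0 : 0 ≤ b₀ := by positivity
  have hb₀le : b₀ ≤ 6 * (c * (t₀ / M)) := by
    rw [hb₀]
    have h1 : Real.pi / 2 ≤ 2 := by linarith [Real.pi_le_four]
    calc Real.pi / 2 * (3 * X₂ * η) ≤ 2 * (3 * X₂ * η) := mul_le_mul_of_nonneg_right h1 (by positivity)
      _ = 6 * (X₂ * η) := by ring
      _ ≤ 6 * (c * (t₀ / M)) := by linarith
  have hb₀' : b₀ ≤ 3 * (c * t₀) := by
    have : c * (t₀ / M) ≤ c * (t₀ / 2) := mul_le_mul_of_nonneg_left htM hc0.le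
    linarith
  have h4b₀ : 4 * b₀ ≤ 1 := by linarith
  have hexp : Real.exp (4 * b₀) - 1 ≤ 8 * b₀ := by
    have h := Real.abs_exp_sub_one_le (x := 4 * b₀) (by rw [abs_of_nonneg (by positivity)]; exact h4b₀)
    rw [abs_of_nonneg (by positivity : (0 : ℝ) ≤ 4 * b₀)] at h
    linarith [le_abs_self (Real.exp (4 * b₀) - 1)]
  have hb₀sq : b₀ * b₀ ≤ 36 * (c ^ 2 * t₀) * η := by
    have h1 : b₀ * b₀ ≤ (6 * (c * (t₀ / M))) * (6 * (c * (t₀ / M))) := mul_le_mul hb₀le hb₀le hb₀0 (by positivity)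
    have h2 : (6 * (c * (t₀ / M))) * (6 * (c * (t₀ / M))) = 36 * (c ^ 2 * t₀) * η := by
      rw [← hMη, ← ht₀]; ring
    linarith
  refine ⟨?_, ?_, ?_, ?_⟩
  · -- `8 b₀ (e^{4b₀} − 1) ≤ 64 b₀² ≤ η`
    have h1 : 8 * b₀ * (Real.exp (4 * b₀) - 1) ≤ 8 * b₀ * (8 * b₀) := mul_le_mul_of_nonneg_left hexp (by positivity)
    have h2 : 64 * (b₀ * b₀) ≤ 64 * (36 * (c ^ 2 * t₀) * η) := by linarith
    have h3 : 64 * (36 * (c ^ 2 * t₀) * η) ≤ η := by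
      have h5 : 64 * (36 * (c ^ 2 * t₀)) ≤ 1 := by linarith
      have h6 : 64 * (36 * (c ^ 2 * t₀) * η) = (64 * (36 * (c ^ 2 * t₀))) * η := by ring
      rw [h6]
      calc (64 * (36 * (c ^ 2 * t₀))) * η ≤ 1 * η := mul_le_mul_of_nonneg_right h5 hη.le
        _ = η := one_mul η
    have h4 : 8 * b₀ * (8 * b₀) = 64 * (b₀ * b₀) := by ring
    show η + 8 * b₀ * (Real.exp (4 * b₀) - 1) ≤ 2 * η
    linarith
  · -- (R1): `576·4096²·X²·2η ≤ 576·4096²·2·c²t₀ ≤ 1`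
    have h1 : 576 * (64 * ((4 : ℕ) : ℝ) ^ 3 * X) ^ 2 * (2 * η) = 19327352832 * (X ^ 2 * η) := by push_cast; ring
    rw [h1]; linarith
  · -- (R2): `Nn·(1 + 8X)·32768·X·2η ≤ Nn·9X·32768X·2η = 294912·Nn·X²η ≤ 294912·Nn·c²t₀ ≤ 1/2`
    simp only [Nat.cast_ofNat]
    have hX0 : 0 ≤ X := by linarith
    have h1 : Nn * (1 + 2 * 4 * X) * (256 * 4 ^ 3 * X * (2 * η)) ≤ Nn * (9 * X) * (256 * 4 ^ 3 * X * (2 * η)) := by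
      have : (1 : ℝ) + 2 * 4 * X ≤ 9 * X := by linarith
      have h0 : (0 : ℝ) ≤ 256 * 4 ^ 3 * X * (2 * η) := by positivity
      have h0' : Nn * (1 + 2 * 4 * X) ≤ Nn * (9 * X) := mul_le_mul_of_nonneg_left this hNn0.le
      exact mul_le_mul_of_nonneg_right h0' h0
    have h2 : Nn * (9 * X) * (256 * 4 ^ 3 * X * (2 * η)) = 294912 * (Nn * (X ^ 2 * η)) := by ring
    have h3 : Nn * (X ^ 2 * η) ≤ Nn * (c ^ 2 * t₀) := mul_le_mul_of_nonneg_left hX2η hNn0.le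
    linarith
  · -- the letter: `16384 X η ≤ 16384 c t₀/M`
    have h1 : 128 * ((4 : ℕ) : ℝ) ^ 3 * X * (2 * η) = 16384 * (X * η) := by push_cast; ring
    rw [h1]
    calc (16384 : ℝ) * (X * η) ≤ 16384 * (c * (t₀ / M)) := by linarith
      _ = 16384 * c * t₀ / M := by ring

/-! ## §2 (8)∃ with THE CHART discharged, every `U(n)`, every `L ≥ 2` -/

set_option maxHeartbeats 800000 in
/-- **P2.4 — F314b GENERIC: ROW NE7's (8)∃ WITH THE LANDAU-CHART INPUT DISCHARGED, every `U(n)`, every `L ≥ 2`, on T⁴** (statement in the file header). [folklore] -/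
theorem hint_generic [Nonempty n] {L : ℕ} (hL : 2 ≤ L) :
    ∃ CE : ℝ, 0 < CE ∧ ∃ ℓ : ℕ, 1 ≤ ℓ ∧ ∃ ε₀ : ℝ, 0 < ε₀ ∧ ∀ ε : ℝ, 0 < ε → ε ≤ ε₀ → ∃ β₀ : ℝ, 0 < β₀ ∧ ∀ β : ℝ, 0 < β → β ≤ β₀ →
    ∀ (N : ℕ) [NeZero N] (αh νh κh : ℝ), 1 ≤ N →
    -- the k-free ceilings `(α̂, ν̂, κ̂)` of the honest per-pair binder and ONE k-free strict line (F327)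
    2 * κh < ((((1 / 2 - νh ^ 2) / (2 * (1 + CE)) - νh ^ 2) / 2 - 576 * ((4 : ℕ) : ℝ) * (αh ^ 2 * Real.exp (2 * αh))) / (Fintype.card n : ℝ) - 28 * ((4 : ℕ) : ℝ) * (ε + 7 * αh ^ 2)) →
    -- THE HONEST PER-PAIR BINDER `hdecomp` on the data class (F327's)
    (∀ D : Site 4 → Fin 4 → (Matrix n n ℂ)ˣ, IsUnitaryCfg D → IsPeriodicCfg D (N : ℤ) → SmallField D (4 * (Real.exp β - 1)) → ∀ (k : ℕ), ∀ Us ∈ admissible (sfClass 4 L N ε) L (k + 1) D, SmallField Us ((1 / (L : ℝ) ^ 2 * ε / 2) / ((L : ℝ) ^ (k + 1)) ^ 2) → (∀ φ : Site 4 → Fin 4 → Matrix n n ℂ, IsSkewDir φ → IsPeriodicDir φ ((N * L ^ (k + 1) : ℕ) : ℤ) → TangentIter L k Us φ → dAction Us φ (perWin 4 (N * L ^ (k + 1))) = 0) → ∀ U' ∈ admissible (sfClass 4 L N ε) L (k + 1) D,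
      ∃ (u : Site 4 → (Matrix n n ℂ)ˣ) (X XT XN : Site 4 → Fin 4 → Matrix n n ℂ) (α ν κ : ℝ),
        IsUnitarySite u ∧ IsSkewDir X ∧ IsPeriodicDir X ((N * L ^ (k + 1) : ℕ) : ℤ) ∧ 0 ≤ α ∧ (∀ x μ, ‖X x μ‖ ≤ α) ∧
        gaugeAct u U' = vary Us X 1 ∧
        X = XT + XN ∧ XT ∈ energyBlockLandauW (d := 4) (n := n) L N (k + 1) Us ∧ IsSkewDir XN ∧ 0 ≤ ν ∧
        energyNormW L (k + 1) Us XN (periodBox (d := 4) (N * L ^ (k + 1)))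
          ≤ ν * energyNormW L (k + 1) Us X (periodBox (d := 4) (N * L ^ (k + 1))) ∧
        ε / ((L : ℝ) ^ (k + 1)) ^ 2 * (∑ p ∈ perWin 4 (N * L ^ (k + 1)), ‖curl Us XN p‖)
          ≤ κ * energyNormW L (k + 1) Us X (periodBox (d := 4) (N * L ^ (k + 1))) ^ 2 ∧
        α * (L : ℝ) ^ (k + 1) ≤ αh ∧ ν ≤ νh ∧ κ ≤ κh) →
    ∃ δV : ℝ, 0 < δV ∧
      ∀ V ∈ {V : Site 4 → Fin 4 → (Matrix n n ℂ)ˣ | IsUnitaryCfg V ∧ IsPeriodicCfg V (N : ℤ) ∧ SmallField V δV},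
      ∀ k : ℕ, ∃ U : Site 4 → Fin 4 → (Matrix n n ℂ)ˣ, IsMinimiser 4 (sfClass 4 L N ε) L N k V U ∧
        ∃ a : ℝ, 0 ≤ a ∧ a < ε / ((L : ℝ) ^ k) ^ 2 ∧ SmallField U a
    := by
  have hL0 : (0 : ℝ) < L := by exact_mod_cast (show 0 < L by omega)
  have hL2r : (2 : ℝ) ≤ (L : ℝ) := by exact_mod_cast hL
  set nb : ℝ := (nbRad 4 L : ℝ) with hnb
  have hnb0 : 0 ≤ nb := Nat.cast_nonneg _
  set Acoef : ℝ := 16384 * (2 * nb + 32) with hAcoef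
  obtain ⟨CE, hCE, ℓ, hℓ1, ε₀, hε₀, H⟩ := hint_of_landauELChart_generic (n := n) hL (A := Acoef) (by positivity) 1
  have hℓ0 : (0 : ℝ) ≤ (ℓ : ℝ) := Nat.cast_nonneg ℓ
  set c : ℝ := 2 * nb + 4 * (ℓ : ℝ) + 28 with hc
  have hc1 : 1 ≤ c := by rw [hc]; linarith
  have hcard1 : (1 : ℝ) ≤ (Fintype.card n : ℝ) := by exact_mod_cast Fintype.card_pos
  set ε₁ : ℝ := 1 / (25000000000 * c ^ 2 * (Fintype.card n : ℝ)) with hε₁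
  refine ⟨CE, hCE, ℓ, hℓ1, min ε₀ ε₁, lt_min hε₀ (by positivity), fun ε hε hεle => ?_⟩
  obtain ⟨β₀, hβ₀, H2⟩ := H ε hε (hεle.trans (min_le_left _ _))
  refine ⟨β₀, hβ₀, fun β hβ hβle N _ αh νh κh hN hline hdecomp => ?_⟩
  have hεε₁ : ε ≤ 1 / (25000000000 * c ^ 2 * (Fintype.card n : ℝ)) := hεle.trans (min_le_right _ _)
  refine H2 β hβ hβle N αh νh κh (16384 * c) hN hline (by positivity) ?_ ?_ hdecomp
  · -- `c₀ = 16384 c ≤ Acoef (ℓ+1)`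
    rw [pow_one, hAcoef, hc]; nlinarith only [mul_nonneg hnb0 hℓ0, hℓ0, hnb0]
  -- (LSUP-EL) from the cube chart
  intro D _ _ _ k U hU _ r hr0 hr hUr z
  have hUu : IsUnitaryCfg U := hU.1.1
  set M : ℝ := (L : ℝ) ^ (k + 1) with hM
  have hM2 : 2 ≤ M := by
    rw [hM]
    calc (2 : ℝ) ≤ L := hL2r
      _ = (L : ℝ) ^ 1 := (pow_one _).symm
      _ ≤ (L : ℝ) ^ (k + 1) := pow_le_pow_right₀ (by linarith) (by omega)
  have hM0 : 0 < M := by linarith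
  set η : ℝ := (r + ε) / ((L : ℝ) ^ (k + 1)) ^ 2 with hη
  have hη0 : 0 < η := by positivity
  have hSη : SmallField U η := MinimalActionRate.SmallField.mono hUr (div_le_div_of_nonneg_right (by linarith only [hε]) (by positivity))
  have ht₀ : M ^ 2 * η = r + ε := by rw [hη, hM]; field_simp
  have hL2sq : (4 : ℝ) ≤ (L : ℝ) ^ 2 := by nlinarith
  have hr4 : r + ε ≤ 5 / 4 * ε := by
    have h1 : 1 / (L : ℝ) ^ 2 * ε ≤ 1 / 4 * ε := by
      apply mul_le_mul_of_nonneg_right _ hε.le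
      exact div_le_div_of_nonneg_left (by norm_num) (by norm_num) hL2sq
    linarith only [hr, h1]
  -- the box sizes
  have hMn : ((L ^ (k + 1) : ℕ) : ℝ) = M := by rw [hM]; push_cast; ring
  have hRr : ((((nbRad 4 L + 2 * ℓ + 12) * L ^ (k + 1) + 2 : ℕ) : ℝ)) = (nb + 2 * (ℓ : ℝ) + 12) * M + 2 := by
    rw [hnb, hM]; push_cast; ring
  have hX : ((2 * ((nbRad 4 L + 2 * ℓ + 12) * L ^ (k + 1) + 2) + 2 + 1 : ℕ) : ℝ) ≤ c * M := by
    have h1 : ((2 * ((nbRad 4 L + 2 * ℓ + 12) * L ^ (k + 1) + 2) + 2 + 1 : ℕ) : ℝ) = 2 * ((nb + 2 * (ℓ : ℝ) + 12) * M + 2) + 3 := by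
      rw [← hRr]; push_cast; ring
    rw [h1, hc]; nlinarith only [hM2, hnb0, hℓ0]
  have hX1 : (1 : ℝ) ≤ ((2 * ((nbRad 4 L + 2 * ℓ + 12) * L ^ (k + 1) + 2) + 2 + 1 : ℕ) : ℝ) := by
    have : 1 ≤ 2 * ((nbRad 4 L + 2 * ℓ + 12) * L ^ (k + 1) + 2) + 2 + 1 := by omega
    exact_mod_cast this
  have hX₂ : ((2 * ((nbRad 4 L + 2 * ℓ + 12) * L ^ (k + 1) + 2) + 2 : ℕ) : ℝ) ≤ c * M := by
    have h1 : ((2 * ((nbRad 4 L + 2 * ℓ + 12) * L ^ (k + 1) + 2) + 2 : ℕ) : ℝ) = 2 * ((nb + 2 * (ℓ : ℝ) + 12) * M + 2) + 2 := by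
      rw [← hRr]; push_cast; ring
    rw [h1, hc]; nlinarith only [hM2, hnb0, hℓ0]
  obtain ⟨hA1, hA2, hA3, hA4⟩ := regime_arith_card (Nn := (Fintype.card n : ℝ)) hM2 hX hX1 hX₂ (Nat.cast_nonneg _) hc1 hη0 ht₀ hr4 hcard1 hεε₁
  obtain ⟨u, A₀, hu, hUA, hskew, hA0, hEL⟩ :=
    cube_landau_chart (n := n) hUu hη0 hSη ((nbRad 4 L + 2 * ℓ + 12) * L ^ (k + 1) + 2) z hA1 hA2 hA3
  refine ⟨u, A₀, hu, hUA, hskew, fun q μ hq => (hA0 q μ hq).trans (hA4.trans ?_), hEL⟩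
  -- `16384 c (r+ε)/M ≤ 16384 c (r + 4(e^β − 1) + ε)/M`
  rw [hM]
  apply div_le_div_of_nonneg_right _ (by positivity)
  apply mul_le_mul_of_nonneg_left _ (by positivity)
  linarith only [Real.add_one_le_exp β, hβ]

end

end Summit.QuantumFields.BalabanUV.T4Continuum.NE7HintOfUhlenbeckChartGeneric
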